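import Summits.HodgeConjecture.HodgeConjecture.Theorems.Q8CommutatorDegreeTwoCoreTransvections
import Literature.AlgebraicGeometry.HodgeTheory.TransvectionMonodromyZariskiDense
import HarnessLib

/-!
# Route `Q8SymplecticPowers` — the QUATERNIONIC LEMMA T: a group of automorphisms containing non-trivial quaternionic
# transvections along a spanning, connected set of `i`-eigenvectors has the whole quaternionic-unitary centraliser in
# the identity component of its Zariski closure (the algebraic half of MON_e for crux K1Q)

Support file for crux K1Q (stmt-HodgeConjecture-24190; `--supports … --as helper`; nothing here closes an item). Prover seat
`hodge-nonav-prover-Ax` (g16), INTENT (o4) 2026-08-29 07:3xZ. Vocabulary of p3's rung `Q8CommutatorDegreeTwoCore*`: a field `K`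
of characteristic `0` with `i`, `i² = −1`; a finite-dimensional `K`-space `V` with a symmetric non-degenerate bilinear form `Q`;
`Q`-isometries `a, b` with `a² = b² = −1`, `ab = −ba` (the typed Q₈ deck pair on `T(X) ⊗ K`); `M = ker (a − i)`; the
QUATERNIONIC TRANSVECTIONS `x ↦ x + l·Q(x, b v)·v − l·Q(x, v)·b v` along `v ∈ M` (§1 of the rung); the alternating form
`ω(x, y) = Q(x, b y)` on `M`.

THEOREM (`mem_glZariskiClosure_of_quaternionic`, `mem_glIdentityComponent_of_quaternionic`). Let `R ⊆ M` span `M` and be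
ω-ORTHOGONALLY CONNECTED (no partition into two non-empty mutually ω-orthogonal parts), and let `Γ ≤ GL(V)` contain, for every
`v ∈ R`, a quaternionic transvection along `v` with a NON-ZERO parameter. Then every `Q`-isometry of `V` commuting with `a` and
`b` lies in `glZariskiClosure Γ`, indeed in `glIdentityComponent Γ` (the intersection of the closures of all finite-index
subgroups, which contain powers of the transvections).

PROOF: Lemma T on `M` (`mem_oneParamTransvectionGroup_of_connected`) after restriction; maps commuting with `b` are
determined on `M` (`V = M ⊕ bM`); closure bookkeeping as in `mem_glZariskiClosure_of_isometry_of_transvections_mem`.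

CONSUMER: the DENSITY hypothesis of the K1Q kernel `q8Comm_of_glIdentityComponent_subset_mumfordTateGroup` (p705733), once the
geometric half of MON_e (BL_e ∕ IRR_e ∕ LOC_e, Route.md r5) supplies `R` and `Γ`. HONEST FRAMING: pure linear algebra (axioms standard, no
named fact); item 24190 OPEN; no statement about the Hodge conjecture.

## References
* [Deligne1980] P. Deligne, La conjecture de Weil II, Publ. Math. IHÉS 52 (1980), §4.4 Lemme (4.4.2^α)–(4.4.4^α), pp. 227–228.
* [CarlsonMullerStachPeters2017] Carlson–Müller-Stach–Peters, Period Mappings and Period Domains, 2nd ed., Lemma–Def. 15.3.7.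
-/

noncomputable section

set_option linter.dupNamespace false

namespace Summit.HodgeConjecture.HodgeConjecture.Theorems.Q8QuaternionicTransvectionDensity

open Literature.AlgebraicGeometry.Motives Literature.AlgebraicGeometry.HodgeTheory
open Summit.HodgeConjecture.HodgeConjecture.Theorems.Q8CommutatorDegreeTwoCoreTransvections

universe u v

variable {K : Type u} [Field K] {V : Type v} [AddCommGroup V] [Module K V]
  {Q : LinearMap.BilinForm K V} {a b : V →ₗ[K] V} {i : K}

/-! ### §1 The quaternionic structure: `V = M ⊕ bM`, maps commuting with `b` are determined on `M` -/

/-- `x − i·a x ∈ M = ker (a − i)` (`a² = −1`, `i² = −1`). -/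
theorem a_sub_smul (haa : ∀ x, a (a x) = -x) (hi : i * i = -1) (x : V) :
    a (x - i • a x) = i • (x - i • a x) := by
  rw [map_sub, map_smul, haa, smul_sub, smul_smul, hi]; module

/-- `a (x + i·a x) = −i·(x + i·a x)`: the complementary eigenvector. -/
theorem a_add_smul (haa : ∀ x, a (a x) = -x) (hi : i * i = -1) (x : V) :
    a (x + i • a x) = (-i) • (x + i • a x) := by
  rw [map_add, map_smul, haa, neg_smul, smul_add, smul_smul, hi]; module

/-- `b` carries the `(−i)`-eigenspace of `a` into `M`: `a (b y) = i·b y` for `a y = −i·y`. -/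
theorem a_b_of_neg (hab : ∀ x, a (b x) = -b (a x)) {y : V} (hy : a y = (-i) • y) : a (b y) = i • b y := by
  rw [hab, hy, map_smul, neg_smul, neg_neg]

/-- **A linear map commuting with `b` and vanishing on `M` vanishes** (`V = M ⊕ bM`, characteristic `≠ 2`). -/
theorem eq_zero_of_comm_b_of_forall_mem [CharZero K] (haa : ∀ x, a (a x) = -x) (hbb : ∀ x, b (b x) = -x)
    (hab : ∀ x, a (b x) = -b (a x)) (hi : i * i = -1) {f : V →ₗ[K] V} (hfb : ∀ x, f (b x) = b (f x))
    (hfM : ∀ m, a m = i • m → f m = 0) : f = 0 := by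
  ext x
  have h1 : f (x - i • a x) = 0 := hfM _ (a_sub_smul haa hi x)
  have h2 : f (x + i • a x) = 0 := by
    have hy : a (b (x + i • a x)) = i • b (x + i • a x) := a_b_of_neg hab (a_add_smul haa hi x)
    have h3 : f (b (b (x + i • a x))) = 0 := by rw [hfb, hfM _ hy, map_zero]
    rw [hbb, map_neg, neg_eq_zero] at h3
    exact h3
  have h4 : f ((2 : K) • x) = 0 := by
    have : (2 : K) • x = (x - i • a x) + (x + i • a x) := by module
    rw [this, map_add, h1, h2, add_zero]
  rw [map_smul] at h4
  exact (smul_eq_zero.1 h4).resolve_left two_ne_zero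

/-- Two automorphisms commuting with `b` that agree on `M` are equal. -/
theorem eq_of_comm_b_of_eqOn [CharZero K] (haa : ∀ x, a (a x) = -x) (hbb : ∀ x, b (b x) = -x)
    (hab : ∀ x, a (b x) = -b (a x)) (hi : i * i = -1) {g h : V ≃ₗ[K] V} (hgb : ∀ x, g (b x) = b (g x))
    (hhb : ∀ x, h (b x) = b (h x)) (hM : ∀ m, a m = i • m → g m = h m) : g = h := by
  have key := eq_zero_of_comm_b_of_forall_mem haa hbb hab hi (f := (g : V →ₗ[K] V) - (h : V →ₗ[K] V))
    (fun x => by simp only [LinearMap.sub_apply, LinearEquiv.coe_coe, hgb, hhb, map_sub])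
    (fun m hm => by simp only [LinearMap.sub_apply, LinearEquiv.coe_coe, hM m hm, sub_self])
  refine LinearEquiv.ext fun x => ?_
  have := LinearMap.congr_fun key x
  simpa only [LinearMap.sub_apply, LinearEquiv.coe_coe, LinearMap.zero_apply, sub_eq_zero] using this

/-- If a unit of `End V` commutes with `f`, so does its inverse. -/
theorem units_inv_comm {f : V →ₗ[K] V} {u : (V →ₗ[K] V)ˣ} (hu : ∀ x, (u : Module.End K V) (f x) = f ((u : Module.End K V) x))
    (x : V) : ((u⁻¹ : (V →ₗ[K] V)ˣ) : Module.End K V) (f x) = f (((u⁻¹ : (V →ₗ[K] V)ˣ) : Module.End K V) x) := by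
  have h : (u : Module.End K V) * f = f * (u : Module.End K V) := LinearMap.ext fun y => hu y
  have h' : ((u⁻¹ : (V →ₗ[K] V)ˣ) : Module.End K V) * f = f * ((u⁻¹ : (V →ₗ[K] V)ˣ) : Module.End K V) := by
    calc ((u⁻¹ : (V →ₗ[K] V)ˣ) : Module.End K V) * f
        = ((u⁻¹ : (V →ₗ[K] V)ˣ) : Module.End K V) * f * ((u : Module.End K V) * ((u⁻¹ : (V →ₗ[K] V)ˣ) : Module.End K V)) := by
          rw [Units.mul_inv, mul_one]
      _ = ((u⁻¹ : (V →ₗ[K] V)ˣ) : Module.End K V) * ((u : Module.End K V) * f) * ((u⁻¹ : (V →ₗ[K] V)ˣ) : Module.End K V) := by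
          rw [h]; simp only [mul_assoc]
      _ = f * ((u⁻¹ : (V →ₗ[K] V)ˣ) : Module.End K V) := by rw [Units.inv_mul_cancel_left]
  exact LinearMap.congr_fun h' x

/-! ### §2 The quaternionic transvection as a one-parameter family of endomorphisms -/

/-- The quaternionic transvection `1 + t·n_v`, `n_v = Q(·, b v)·v − Q(·, v)·b v`, evaluated. -/
theorem qNil_apply (v x : V) (t : K) :
    (LinearMap.id + t • ((Q.flip (b v)).smulRight v - (Q.flip v).smulRight (b v)) : V →ₗ[K] V) x =
      x + (t * Q x (b v)) • v + (-(t * Q x v)) • b v := by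
  simp only [LinearMap.add_apply, LinearMap.id_apply, LinearMap.smul_apply, LinearMap.sub_apply,
    LinearMap.smulRight_apply, smul_sub, smul_smul, neg_smul]
  abel

section Structure

variable [CharZero K] (hQs : ∀ x y, Q x y = Q y x) (haQ : ∀ x y, Q (a x) (a y) = Q x y)
  (hbb : ∀ x, b (b x) = -x) (hQb : ∀ x y, Q (b x) (b y) = Q x y) (hi : i * i = -1)
include hQs haQ hbb hQb hi

/-- **Powers of a quaternionic transvection**: if `T x = x + l Q(x, bv) v − l Q(x, v) bv` then `T^k` is the transvection with
parameter `k·l` (the one-parameter law `qtransvection_comp` of the rung). -/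
theorem qtransvection_pow {v : V} (hv : a v = i • v) {l : K} {T : V ≃ₗ[K] V}
    (hT : ∀ x, T x = x + (l * Q x (b v)) • v + (-(l * Q x v)) • b v) (k : ℕ) (x : V) :
    (T ^ k) x = x + (((k : K) * l) * Q x (b v)) • v + (-(((k : K) * l) * Q x v)) • b v := by
  induction k generalizing x with
  | zero =>
    rw [pow_zero, Nat.cast_zero, zero_mul, zero_mul, zero_mul, neg_zero, zero_smul, zero_smul, add_zero, add_zero]
    rfl
  | succ k ih =>
    rw [pow_succ, LinearEquiv.mul_apply, ih (T x)]
    have h := qtransvection_comp hQs haQ hbb hQb hi hv (T := fun y => y + (((k : K) * l) * Q y (b v)) • v +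
      (-(((k : K) * l) * Q y v)) • b v) (T' := fun y => T y) (l := (k : K) * l) (l' := l) (fun y => rfl) hT x
    have hkl : ((k : K) + 1) * l = (k : K) * l + l := by ring
    rw [h, Nat.cast_succ, hkl]

end Structure

/-! ### §3 The quaternionic Lemma T -/

/-- **QUATERNIONIC LEMMA T (Zariski-closure form).** `K` of characteristic `0` with `i² = −1`; `V` finite-dimensional with a
symmetric non-degenerate `Q`; `a, b` `Q`-isometries with `a² = b² = −1`, `ab = −ba`; `R` a set of `i`-eigenvectors of `a`
spanning `M = ker(a − i)` and ω-orthogonally connected for `ω(x,y) = Q(x, b y)`; `Γ ≤ GL(V)` containing a quaternionic transvection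
with non-zero parameter along every `v ∈ R`. Then every `Q`-isometry `g` commuting with `a` and `b` lies in `glZariskiClosure Γ`.
[cite: Deligne1980, §4.4 Lemme (4.4.2^α)–(4.4.4^α) pp. 227–228] [cite: CarlsonMullerStachPeters2017, Lemma–Definition 15.3.7] -/
theorem mem_glZariskiClosure_of_quaternionic [CharZero K] [Module.Finite K V]
    (hQs : ∀ x y, Q x y = Q y x) (hQn : Q.Nondegenerate)
    (haa : ∀ x, a (a x) = -x) (hbb : ∀ x, b (b x) = -x) (hab : ∀ x, a (b x) = -b (a x))
    (haQ : ∀ x y, Q (a x) (a y) = Q x y) (hQb : ∀ x y, Q (b x) (b y) = Q x y) (hi : i * i = -1)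
    {R : Set V} (hRM : ∀ v ∈ R, a v = i • v)
    (hspan : ∀ m, a m = i • m → m ∈ Submodule.span K R)
    (hconn : ∀ A ⊆ R, A.Nonempty → A ≠ R → ∃ r ∈ A, ∃ ρ ∈ R, ρ ∉ A ∧ Q r (b ρ) ≠ 0)
    {Γ : Subgroup (V ≃ₗ[K] V)}
    (hΓ : ∀ v ∈ R, ∃ l : K, l ≠ 0 ∧ ∃ T ∈ Γ, ∀ x, T x = x + (l * Q x (b v)) • v + (-(l * Q x v)) • b v)
    {g : V ≃ₗ[K] V} (hga : ∀ x, g (a x) = a (g x)) (hgb : ∀ x, g (b x) = b (g x))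
    (hgQ : ∀ x y, Q (g x) (g y) = Q x y) : g ∈ glZariskiClosure Γ := by
  classical
  haveI : Infinite K := Infinite.of_injective ((↑) : ℕ → K) Nat.cast_injective
  let bV := Module.Free.chooseBasis K V
  set S : Set (Module.End K V) := (fun h : V ≃ₗ[K] V => (h : Module.End K V)) '' (Γ : Set (V ≃ₗ[K] V))
    with hSdef
  have hSmul : ∀ x ∈ S, ∀ y ∈ S, x * y ∈ S := by
    rintro _ ⟨x, hx, rfl⟩ _ ⟨y, hy, rfl⟩
    exact ⟨x * y, Γ.mul_mem hx hy, rfl⟩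
  let N : V → Module.End K V := fun v => (Q.flip (b v)).smulRight v - (Q.flip v).smulRight (b v)
  have hNapp : ∀ v (t : K) x, ((1 : Module.End K V) + t • N v) x = x + (t * Q x (b v)) • v + (-(t * Q x v)) • b v :=
    fun v t x => qNil_apply (Q := Q) (b := b) v x t
  -- ### (1) each full one-parameter group along `v ∈ R` lies in the closure
  have hU : ∀ v ∈ R, ∀ t : K, (1 : Module.End K V) + t • N v ∈ zariskiClosureEndOfBasis bV S := by
    intro v hv t
    obtain ⟨l, hl, T, hTΓ, hT⟩ := hΓ v hv
    refine one_add_smul_mem_zariskiClosureEndOfBasis bV _ ?_ t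
    have hinj : Function.Injective fun k : ℕ => (k : K) * l :=
      fun k k' hkk => Nat.cast_injective (mul_right_cancel₀ hl hkk)
    refine (Set.infinite_range_of_injective hinj).mono ?_
    rintro _ ⟨k, rfl⟩
    refine ⟨T ^ k, Γ.pow_mem hTΓ k, ?_⟩
    refine LinearMap.ext fun x => ?_
    change (T ^ k) x = _
    rw [qtransvection_pow hQs haQ hbb hQb hi (hRM v hv) hT k x, hNapp]
  -- ### (2) the units whose map and inverse lie in the closure form a subgroup
  let Tsub : Subgroup (V →ₗ[K] V)ˣ :=
    { carrier := {m | (m : Module.End K V) ∈ zariskiClosureEndOfBasis bV S ∧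
        ((m⁻¹ : (V →ₗ[K] V)ˣ) : Module.End K V) ∈ zariskiClosureEndOfBasis bV S}
      mul_mem' := fun {x y} hx hy => ⟨by
          rw [Units.val_mul]; exact mul_mem_zariskiClosureEndOfBasis bV hSmul hx.1 hy.1, by
          rw [_root_.mul_inv_rev, Units.val_mul]; exact mul_mem_zariskiClosureEndOfBasis bV hSmul hy.2 hx.2⟩
      one_mem' := by
        have h1 : (1 : Module.End K V) ∈ S := ⟨1, Γ.one_mem, rfl⟩
        exact ⟨subset_zariskiClosureEndOfBasis bV S h1, by
          rw [inv_one]; exact subset_zariskiClosureEndOfBasis bV S h1⟩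
      inv_mem' := fun {x} hx => ⟨hx.2, by rw [inv_inv]; exact hx.1⟩ }
  -- ### (3) the quaternionic one-parameter units along `R` and the group `QM` they generate
  -- the unit with map `1 + t N v` and inverse `1 + (-t) N v`
  have hNcomp : ∀ v, a v = i • v → ∀ t t' : K,
      ((1 : Module.End K V) + t • N v) * ((1 : Module.End K V) + t' • N v) = (1 : Module.End K V) + (t + t') • N v := by
    intro v hv t t'
    refine LinearMap.ext fun x => ?_
    rw [Module.End.mul_apply, hNapp v (t + t') x]
    exact qtransvection_comp hQs haQ hbb hQb hi hv (hNapp v t) (hNapp v t') x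
  have hUinv : ∀ v, a v = i • v → ∀ t : K,
      ((1 : Module.End K V) + t • N v) * ((1 : Module.End K V) + (-t) • N v) = 1 ∧
        ((1 : Module.End K V) + (-t) • N v) * ((1 : Module.End K V) + t • N v) = 1 := by
    intro v hv t
    refine ⟨?_, ?_⟩
    · rw [hNcomp v hv, add_neg_cancel, zero_smul, add_zero]
    · rw [hNcomp v hv, neg_add_cancel, zero_smul, add_zero]
  let qU : ∀ v, a v = i • v → K → (V →ₗ[K] V)ˣ := fun v hv t =>
    ⟨(1 : Module.End K V) + t • N v, (1 : Module.End K V) + (-t) • N v, (hUinv v hv t).1, (hUinv v hv t).2⟩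
  have hqU : ∀ v hv t, ((qU v hv t : (V →ₗ[K] V)ˣ) : Module.End K V) = 1 + t • N v := fun _ _ _ => rfl
  have hqUinv : ∀ v hv t, (((qU v hv t)⁻¹ : (V →ₗ[K] V)ˣ) : Module.End K V) = 1 + (-t) • N v := fun _ _ _ => rfl
  let gens : Set (V →ₗ[K] V)ˣ := {u | ∃ v, ∃ hv : v ∈ R, ∃ t : K, u = qU v (hRM v hv) t}
  let QM : Subgroup (V →ₗ[K] V)ˣ := Subgroup.closure gens
  have hQMT : QM ≤ Tsub := by
    refine (Subgroup.closure_le Tsub).2 ?_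
    rintro u ⟨v, hv, t, rfl⟩
    exact ⟨by rw [hqU v (hRM v hv) t]; exact hU v hv t, by rw [hqUinv v (hRM v hv) t]; exact hU v hv (-t)⟩
  -- ### (4) `g ∈ QM`, seen on `M`: elements of `QM` commute with `a` and `b`
  have hQMa : ∀ u ∈ QM, ∀ x, (u : Module.End K V) (a x) = a ((u : Module.End K V) x) := by
    intro u hu
    induction hu using Subgroup.closure_induction with
    | mem u hu =>
      obtain ⟨v, hv, t, rfl⟩ := hu
      intro x
      rw [hqU v (hRM v hv) t]
      exact qtransvection_comm_a haQ hi (hRM v hv) hab (hNapp v t) x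
    | one => intro x; rfl
    | mul u w _ _ hu hw => intro x; rw [Units.val_mul, Module.End.mul_apply, Module.End.mul_apply, hw, hu]
    | inv u _ hu => exact units_inv_comm hu
  have hQMb : ∀ u ∈ QM, ∀ x, (u : Module.End K V) (b x) = b ((u : Module.End K V) x) := by
    intro u hu
    induction hu using Subgroup.closure_induction with
    | mem u hu =>
      obtain ⟨v, hv, t, rfl⟩ := hu
      intro x
      rw [hqU v (hRM v hv) t]
      exact qtransvection_comm_b hQs hbb hQb (hNapp v t) x
    | one => intro x; rfl
    | mul u w _ _ hu hw => intro x; rw [Units.val_mul, Module.End.mul_apply, Module.End.mul_apply, hw, hu]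
    | inv u _ hu => exact units_inv_comm hu
  -- the eigenspace `M` and the alternating form `ω` on it
  let M : Submodule K V := Module.End.eigenspace a i
  have hmemM : ∀ {x : V}, x ∈ M ↔ a x = i • x := fun {x} => Module.End.mem_eigenspace_iff
  let ω : LinearMap.BilinForm K M := Q.compl₁₂ M.subtype (b ∘ₗ M.subtype)
  have hωapp : ∀ x y : M, ω x y = Q (x : V) (b (y : V)) := fun x y => rfl
  have hωalt : ω.IsAlt := fun x => by
    change Q (x : V) (b (x : V)) = 0
    exact b_self hQs hbb hQb (x : V)
  have hωn : ω.Nondegenerate := by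
    refine (LinearMap.IsRefl.nondegenerate_iff_separatingLeft hωalt.isRefl).2 fun m hm => ?_
    have hmM : a (m : V) = i • (m : V) := hmemM.1 m.2
    have hzero : ∀ z : V, Q (m : V) z = 0 := by
      intro z
      have h1 : Q (m : V) (z - i • a z) = 0 := eigen_isotropic haQ hi hmM (a_sub_smul haa hi z)
      have hy : a (b (z + i • a z)) = i • b (z + i • a z) := a_b_of_neg hab (a_add_smul haa hi z)
      have h2 : Q (m : V) (b (b (z + i • a z))) = 0 := by
        have := hm ⟨b (z + i • a z), hmemM.2 hy⟩
        rwa [hωapp] at this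
      rw [hbb, map_neg, neg_eq_zero] at h2
      have h3 : Q (m : V) ((2 : K) • z) = 0 := by
        have : (2 : K) • z = (z - i • a z) + (z + i • a z) := by module
        rw [this, map_add, h1, h2, add_zero]
      rw [map_smul, smul_eq_mul] at h3
      exact (mul_eq_zero.1 h3).resolve_left two_ne_zero
    exact Subtype.ext (hQn.1 (m : V) hzero)
  -- the set `R` read in `M`
  let RM : Set M := {m | (m : V) ∈ R}
  have hRMspan : Submodule.span K RM = ⊤ := by
    rw [eq_top_iff]
    rintro m -
    have hm : (m : V) ∈ Submodule.span K R := hspan _ (hmemM.1 m.2)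
    have : (m : V) ∈ (Submodule.span K RM).map M.subtype := by
      rw [Submodule.map_span]
      refine Submodule.span_mono ?_ hm
      intro r hr
      exact ⟨⟨r, hmemM.2 (hRM r hr)⟩, hr, rfl⟩
    obtain ⟨m', hm', hmm'⟩ := this
    have : m' = m := Subtype.ext hmm'
    rwa [this] at hm'
  have hRMconn : ∀ A ⊆ RM, A.Nonempty → A ≠ RM → ∃ r ∈ A, ∃ ρ ∈ RM, ρ ∉ A ∧ ω r ρ ≠ 0 := by
    intro A hA hAne hAneq
    let A' : Set V := Subtype.val '' A
    have hA' : A' ⊆ R := by rintro _ ⟨m, hm, rfl⟩; exact hA hm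
    have hA'ne : A'.Nonempty := hAne.image _
    have hA'neq : A' ≠ R := by
      intro h
      apply hAneq
      ext m
      refine ⟨fun hm => hA hm, fun hm => ?_⟩
      have : (m : V) ∈ A' := by rw [h]; exact hm
      obtain ⟨m', hm', hmm'⟩ := this
      rwa [← Subtype.ext hmm']
    obtain ⟨r, hr, ρ, hρ, hρA, hrρ⟩ := hconn A' hA' hA'ne hA'neq
    obtain ⟨rm, hrm, rfl⟩ := hr
    refine ⟨rm, hrm, ⟨ρ, hmemM.2 (hRM ρ hρ)⟩, hρ, fun h => hρA ⟨_, h, rfl⟩, ?_⟩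
    rwa [hωapp]
  -- restriction to `M` of units commuting with `a`, as a homomorphism on the subgroup `Za`
  let Za : Subgroup (V →ₗ[K] V)ˣ :=
    { carrier := {u | ∀ x, (u : Module.End K V) (a x) = a ((u : Module.End K V) x)}
      mul_mem' := fun {u w} hu hw x => by rw [Units.val_mul, Module.End.mul_apply, Module.End.mul_apply, hw, hu]
      one_mem' := fun x => rfl
      inv_mem' := fun {u} hu x => units_inv_comm hu x }
  have hstab : ∀ u : Za, ∀ x ∈ M, (u.1 : Module.End K V) x ∈ M := fun u x hx => by
    rw [hmemM] at hx ⊢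
    rw [← u.2 x, hx, map_smul]
  have hstabinv : ∀ u : Za, ∀ x ∈ M, ((u.1⁻¹ : (V →ₗ[K] V)ˣ) : Module.End K V) x ∈ M := fun u x hx =>
    hstab ⟨u.1⁻¹, Za.inv_mem u.2⟩ x hx
  let ρ : Za →* (M →ₗ[K] M)ˣ :=
    { toFun := fun u => ⟨(u.1 : Module.End K V).restrict (hstab u), ((u.1⁻¹ : (V →ₗ[K] V)ˣ) : Module.End K V).restrict (hstabinv u),
        by
          refine LinearMap.ext fun m => Subtype.ext ?_
          change (u.1 : Module.End K V) (((u.1⁻¹ : (V →ₗ[K] V)ˣ) : Module.End K V) m) = m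
          rw [← Module.End.mul_apply, ← Units.val_mul, mul_inv_cancel, Units.val_one, Module.End.one_apply],
        by
          refine LinearMap.ext fun m => Subtype.ext ?_
          change ((u.1⁻¹ : (V →ₗ[K] V)ˣ) : Module.End K V) ((u.1 : Module.End K V) m) = m
          rw [← Module.End.mul_apply, ← Units.val_mul, inv_mul_cancel, Units.val_one, Module.End.one_apply]⟩
      map_one' := by
        refine Units.ext (LinearMap.ext fun m => Subtype.ext ?_)
        rfl
      map_mul' := fun u w => by
        refine Units.ext (LinearMap.ext fun m => Subtype.ext ?_)
        rfl }
  have hρapp : ∀ (u : Za) (m : M), ((ρ u : (M →ₗ[K] M)ˣ) : M →ₗ[K] M) m = ⟨(u.1 : Module.End K V) m, hstab u m m.2⟩ :=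
    fun u m => rfl
  -- `QM ≤ Za` and `g ∈ Za`
  have hQMZa : QM ≤ Za := fun u hu => hQMa u hu
  let gU : (V →ₗ[K] V)ˣ := LinearMap.GeneralLinearGroup.ofLinearEquiv g
  have hgU : (gU : Module.End K V) = (g : Module.End K V) := rfl
  have hgZa : gU ∈ Za := fun x => hga x
  -- the restriction of `g` preserves `ω`, hence lies in Deligne's group on `M`
  have hρg : ρ ⟨gU, hgZa⟩ ∈ oneParamTransvectionGroup ω RM := by
    refine mem_oneParamTransvectionGroup_of_connected hωalt hωn hRMspan hRMconn fun x y => ?_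
    rw [hρapp, hρapp, hωapp, hωapp]
    change Q (g (x : V)) (b (g (y : V))) = Q (x : V) (b (y : V))
    rw [← hgb, hgQ]
  -- Deligne's group on `M` is the image of `QM`
  have himage : oneParamTransvectionGroup ω RM ≤ (QM.subgroupOf Za).map ρ := by
    refine (Subgroup.closure_le _).2 ?_
    rintro u' ⟨δ, hδ, c, hu'⟩
    have hδa : a (δ : V) = i • (δ : V) := hmemM.1 δ.2
    refine ⟨⟨qU δ hδa c, hQMZa (Subgroup.subset_closure ⟨δ, hδ, c, rfl⟩)⟩, ?_, ?_⟩
    · rw [SetLike.mem_coe, Subgroup.mem_subgroupOf]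
      exact Subgroup.subset_closure ⟨δ, hδ, c, rfl⟩
    · refine Units.ext (LinearMap.ext fun m => Subtype.ext ?_)
      rw [hu', oneParamTransvection_apply, hρapp]
      change ((1 : Module.End K V) + c • N δ) (m : V) = ((m + (c * ω m δ) • δ : M) : V)
      rw [hNapp, Submodule.coe_add, Submodule.coe_smul, hωapp,
        eigen_isotropic haQ hi (hmemM.1 m.2) hδa, mul_zero, neg_zero, zero_smul, add_zero]
  obtain ⟨⟨h, hhZa⟩, hhQM, hρh⟩ := himage hρg
  rw [SetLike.mem_coe, Subgroup.mem_subgroupOf] at hhQM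
  -- `h = g`: both commute with `b` and agree on `M`
  have hhg : (h : Module.End K V) = (g : Module.End K V) := by
    have hb' : ∀ x, (h : Module.End K V) (b x) = b ((h : Module.End K V) x) := hQMb h hhQM
    have hM' : ∀ m, a m = i • m → (h : Module.End K V) m = g m := by
      intro m hm
      have := congrArg (fun u : (M →ₗ[K] M)ˣ => ((u : M →ₗ[K] M) ⟨m, hmemM.2 hm⟩ : V)) hρh
      simp only [hρapp] at this
      exact this
    have key := eq_zero_of_comm_b_of_forall_mem haa hbb hab hi (f := (h : Module.End K V) - (g : Module.End K V))
      (fun x => by simp only [LinearMap.sub_apply, LinearEquiv.coe_coe, hb', hgb, map_sub])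
      (fun m hm => by simp only [LinearMap.sub_apply, LinearEquiv.coe_coe, hM' m hm, sub_self])
    exact sub_eq_zero.1 key
  -- conclude
  have hmem : (g : Module.End K V) ∈ zariskiClosureEndOfBasis bV S := by
    rw [← hhg]; exact (hQMT hhQM).1
  rw [mem_glZariskiClosure_iff, ← zariskiClosureEnd_basis_indep bV]
  exact hmem

/-- **QUATERNIONIC LEMMA T (identity-component form)**: under the hypotheses of `mem_glZariskiClosure_of_quaternionic`, every
`Q`-isometry commuting with `a` and `b` lies in `glIdentityComponent Γ` (a finite-index `Γ' ≤ Γ` contains positive powers of the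
transvections, `qtransvection_pow`) — the DENSITY currency of the K1Q kernel `q8Comm_of_glIdentityComponent_subset_mumfordTateGroup`.
[cite: Deligne1980, §4.4 Lemme (4.4.2^α)–(4.4.4^α) pp. 227–228] [cite: CarlsonMullerStachPeters2017, Lemma–Definition 15.3.7 and proof of Proposition 15.3.9] -/
theorem mem_glIdentityComponent_of_quaternionic [CharZero K] [Module.Finite K V]
    (hQs : ∀ x y, Q x y = Q y x) (hQn : Q.Nondegenerate)
    (haa : ∀ x, a (a x) = -x) (hbb : ∀ x, b (b x) = -x) (hab : ∀ x, a (b x) = -b (a x))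
    (haQ : ∀ x y, Q (a x) (a y) = Q x y) (hQb : ∀ x y, Q (b x) (b y) = Q x y) (hi : i * i = -1)
    {R : Set V} (hRM : ∀ v ∈ R, a v = i • v)
    (hspan : ∀ m, a m = i • m → m ∈ Submodule.span K R)
    (hconn : ∀ A ⊆ R, A.Nonempty → A ≠ R → ∃ r ∈ A, ∃ ρ ∈ R, ρ ∉ A ∧ Q r (b ρ) ≠ 0)
    {Γ : Subgroup (V ≃ₗ[K] V)}
    (hΓ : ∀ v ∈ R, ∃ l : K, l ≠ 0 ∧ ∃ T ∈ Γ, ∀ x, T x = x + (l * Q x (b v)) • v + (-(l * Q x v)) • b v)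
    {g : V ≃ₗ[K] V} (hga : ∀ x, g (a x) = a (g x)) (hgb : ∀ x, g (b x) = b (g x))
    (hgQ : ∀ x y, Q (g x) (g y) = Q x y) : g ∈ glIdentityComponent Γ := by
  rw [mem_glIdentityComponent_iff]
  intro Γ' _ hfi
  have hidx : (Γ'.subgroupOf Γ).index ≠ 0 := hfi.index_ne_zero
  refine mem_glZariskiClosure_of_quaternionic hQs hQn haa hbb hab haQ hQb hi hRM hspan hconn (Γ := Γ') ?_ hga hgb hgQ
  intro v hv
  obtain ⟨l, hl, T, hTΓ, hT⟩ := hΓ v hv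
  obtain ⟨m, hm0, -, hm⟩ := Subgroup.exists_pow_mem_of_index_ne_zero hidx (⟨T, hTΓ⟩ : Γ)
  rw [Subgroup.mem_subgroupOf, Subgroup.coe_pow] at hm
  exact ⟨(m : K) * l, mul_ne_zero (Nat.cast_ne_zero.2 hm0.ne') hl, T ^ m, hm,
    qtransvection_pow hQs haQ hbb hQb hi (hRM v hv) hT m⟩

end Summit.HodgeConjecture.HodgeConjecture.Theorems.Q8QuaternionicTransvectionDensity

end
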